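import Summits.Ventures.HodgeRepro.CosetQuadCore

/-!
# Route-2's Theorem T, sub-case (ii), at `k = 3` — the `C₃ ⋊ D₄` row of degree 24 on the kernel

Blind re-derivation cell `pub-hodge-repro`, seat `p1` (gen 12).  Route-2's Theorem T (INBOX L1177, ROUTE-B §9.39)
has two sub-cases: (i) `c ∈ ⟨v⟩` (`TwistedQuad16.lean`, `TwistedQuadGen.lean`) and (ii) `c ∉ ⟨v⟩`, where
`N = ⟨v⟩ × ⟨c⟩` has index 2 in `H = ⟨u, v, c⟩`, `u² = 1`, `u v u = c v^ε`.  The degree-24 table of ROUTE-B §9.36(a)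
has ONE row of sub-case (ii): `C₃ ⋊ D₄ = (24, 8)`, `ε = −`, `k = 3` (`v` of order 6, `u v u⁻¹ = c v⁻¹`), with 12
instances per pointed `Δ_T = {1, u, v, vu}`.  This file puts its existence on the kernel for every finite `(G, c)`:
the model `(ℤ/6 × ℤ/2) ⋊ ℤ/2` with the generator acting by `τ(n, e) = (−n, n + e)` (i.e. `v ↦ c v⁻¹`, `c ↦ c`),
`c = (0, 1)`, finite and decidable; the hom `modelHomII : (n, e, g) ↦ vⁿ cᵉ uᵍ` from `v, c, u ∈ G` with `v⁶ = 1`,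
`u² = 1`, `u v u⁻¹ = c v⁻¹`, `c` central (injective for `v` of order 6, `c ∉ ⟨v⟩`, `u ∉ ⟨v, c⟩`); the decided
pattern `rectII` and gen 10's `exists_quad_of_pattern`.  Witness from proofs/p1-g12/tswitnessII.py (12 instances on
the model = route-2's `2^{k+1} − 4 − 4[k even]` at `k = 3`).
-/

set_option autoImplicit false

open Finset Multiplicative
open scoped Pointwise

namespace HodgeRepro.TwistedQuadII

open HodgeRepro.CosetQuad

/-! ### The model group `(ℤ/6 × ℤ/2) ⋊ ℤ/2` -/

/-- `N = ⟨v⟩ × ⟨c⟩ = ℤ/6 × ℤ/2` (multiplicative). -/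
abbrev NII : Type := Multiplicative (ZMod 6) × Multiplicative (ZMod 2)

/-- The involutive automorphism `τ(n, e) = (−n, n + e)` of `N` (`v ↦ c v⁻¹`, `c ↦ c`). -/
def tauII : NII ≃* NII where
  toFun x := (x.1⁻¹, ofAdd (((toAdd x.1).val : ZMod 2) + toAdd x.2))
  invFun x := (x.1⁻¹, ofAdd (((toAdd x.1).val : ZMod 2) + toAdd x.2))
  left_inv := by decide
  right_inv := by decide
  map_mul' := by decide

/-- `τ` is an involution. -/
theorem tauII_sq : tauII ^ 2 = 1 :=
  MulEquiv.ext (by decide : ∀ x : NII, (tauII ^ 2) x = (1 : MulAut NII) x)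

/-- The action `ℤ/2 →* Aut(N)`, the generator acting by `τ`. -/
def phiII : Multiplicative (ZMod 2) →* MulAut NII := zmodPowHom 2 tauII tauII_sq

/-- `phiII` on `0`. -/
theorem phiII_zero : phiII (ofAdd 0) = 1 := by
  rw [phiII, zmodPowHom_apply, toAdd_ofAdd, ZMod.val_zero, pow_zero]

/-- `phiII` on the generator. -/
theorem phiII_one : phiII (ofAdd 1) = tauII := by
  rw [phiII, zmodPowHom_apply, toAdd_ofAdd, val_one_two, pow_one]

/-- The model group `H = N ⋊ ⟨u⟩` of order 24 (`C₃ ⋊ D₄`). -/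
abbrev HII : Type := NII ⋊[phiII] Multiplicative (ZMod 2)

/-- `HII` is a finite type (through the product of its two coordinates). -/
instance : Fintype HII :=
  Fintype.ofEquiv (NII × Multiplicative (ZMod 2))
    { toFun := fun p => ⟨p.1, p.2⟩, invFun := fun x => (x.left, x.right),
      left_inv := fun _ => rfl, right_inv := fun _ => rfl }

/-- Equality on `HII` is decidable (coordinatewise). -/
instance : DecidableEq HII := fun x y =>
  decidable_of_iff (x.left = y.left ∧ x.right = y.right)
    ⟨fun h => SemidirectProduct.ext h.1 h.2, fun h => ⟨congrArg _ h, congrArg _ h⟩⟩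

/-- `v = ((1, 0), 0)`, of order 6. -/
def vII : HII := SemidirectProduct.inl (ofAdd 1, 1)

/-- `c = ((0, 1), 0)`, the central involution outside `⟨v⟩`. -/
def cII : HII := SemidirectProduct.inl (1, ofAdd 1)

/-- `u = ((0, 0), 1)`, the involution with `u v u⁻¹ = c v⁻¹`. -/
def uII : HII := SemidirectProduct.inr (ofAdd 1)

/-- The twisted rectangle `{1, u, v, v u}`. -/
def rectTII : Fin 4 → HII := ![1, uII, vII, vII * uII]

/-- An instance on the model (coordinates `((n, e), g) ↦ vⁿ cᵉ uᵍ`). -/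
def rectII : Finset HII :=
  {⟨(ofAdd 0, ofAdd 0), ofAdd 0⟩, ⟨(ofAdd 0, ofAdd 0), ofAdd 1⟩, ⟨(ofAdd 1, ofAdd 0), ofAdd 1⟩,
    ⟨(ofAdd 1, ofAdd 1), ofAdd 0⟩, ⟨(ofAdd 2, ofAdd 0), ofAdd 1⟩, ⟨(ofAdd 2, ofAdd 1), ofAdd 0⟩,
    ⟨(ofAdd 3, ofAdd 0), ofAdd 0⟩, ⟨(ofAdd 3, ofAdd 1), ofAdd 1⟩, ⟨(ofAdd 4, ofAdd 0), ofAdd 0⟩,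
    ⟨(ofAdd 4, ofAdd 1), ofAdd 1⟩, ⟨(ofAdd 5, ofAdd 0), ofAdd 1⟩, ⟨(ofAdd 5, ofAdd 1), ofAdd 0⟩}

/-- The model has order 24. -/
theorem card_HII : Fintype.card HII = 24 := by decide

/-! ### Transport -/

variable {G : Type*} [Group G]

/-- The hom `N →* G`, `(n, e) ↦ vⁿ cᵉ`, for `v⁶ = 1`, `c² = 1`, `v c = c v`. -/
def nHom (v c : G) (hv : v ^ 6 = 1) (hc2 : c ^ 2 = 1) (hvc : v * c = c * v) : NII →* G :=
  (zmodPowHom 6 v hv).noncommCoprod (zmodPowHom 2 c hc2) (fun _ _ => Commute.pow_pow (hvc : Commute v c) _ _)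

/-- `nHom (n, e) = vⁿ cᵉ`. -/
theorem nHom_apply (v c : G) (hv : v ^ 6 = 1) (hc2 : c ^ 2 = 1) (hvc : v * c = c * v) (n : ZMod 6)
    (e : ZMod 2) : nHom v c hv hc2 hvc (ofAdd n, ofAdd e) = v ^ n.val * c ^ e.val := by
  rw [nHom, MonoidHom.noncommCoprod_apply, zmodPowHom_apply, zmodPowHom_apply, toAdd_ofAdd, toAdd_ofAdd]

/-- Every element of `N` is `(v, 1)ⁿ (1, c)ᵉ`. -/
theorem NII_decomp : ∀ x : NII, x = (ofAdd 1, 1) ^ (toAdd x.1).val * (1, ofAdd 1) ^ (toAdd x.2).val := by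
  decide

/-- `τ` on the two generators. -/
theorem tauII_gen : tauII (ofAdd 1, 1) = (ofAdd 5, ofAdd 1) ∧ tauII (1, ofAdd 1) = (1, ofAdd 1) := by
  decide

/-- The compatibility of `nHom` with `τ` on the generators. -/
theorem nHom_tau_gen (v c u : G) (hv : v ^ 6 = 1) (hc2 : c ^ 2 = 1) (hvc : v * c = c * v)
    (huv : u * v * u⁻¹ = c * v⁻¹) (huc : u * c * u⁻¹ = c) :
    nHom v c hv hc2 hvc (tauII (ofAdd 1, 1)) = u * nHom v c hv hc2 hvc (ofAdd 1, 1) * u⁻¹ ∧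
    nHom v c hv hc2 hvc (tauII (1, ofAdd 1)) = u * nHom v c hv hc2 hvc (1, ofAdd 1) * u⁻¹ := by
  have h5 : (5 : ZMod 6).val = 5 := by decide
  have h1 : (1 : ZMod 6).val = 1 := by decide
  have e1 : ((ofAdd 1, 1) : NII) = (ofAdd 1, ofAdd 0) := rfl
  have e2 : ((1, ofAdd 1) : NII) = (ofAdd 0, ofAdd 1) := rfl
  have hinv : v ^ 5 = v⁻¹ := eq_inv_of_mul_eq_one_left (by rw [← pow_succ]; exact hv)
  constructor
  · rw [tauII_gen.1, e1, nHom_apply, nHom_apply, h5, h1, ZMod.val_zero, val_one_two, pow_one, pow_zero, mul_one,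
      pow_one, huv, hinv]
    exact (Commute.inv_left (hvc : Commute v c)).eq
  · rw [tauII_gen.2, e2, nHom_apply, ZMod.val_zero, val_one_two, pow_zero, pow_one, one_mul, huc]

/-- The compatibility of `nHom` with `τ`: `nHom (τ x) = u · nHom x · u⁻¹`. -/
theorem nHom_compat (v c u : G) (hv : v ^ 6 = 1) (hc2 : c ^ 2 = 1) (hvc : v * c = c * v) (hu : u ^ 2 = 1)
    (huv : u * v * u⁻¹ = c * v⁻¹) (huc : u * c * u⁻¹ = c) (g : Multiplicative (ZMod 2)) :
    (nHom v c hv hc2 hvc).comp (MulEquiv.toMonoidHom (phiII g)) =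
      (MulEquiv.toMonoidHom (MulAut.conj (zmodPowHom 2 u hu g))).comp (nHom v c hv hc2 hvc) := by
  obtain ⟨gv, gc⟩ := nHom_tau_gen v c u hv hc2 hvc huv huc
  obtain ⟨g, rfl⟩ := ofAdd.surjective g
  refine MonoidHom.ext (fun x => ?_)
  rw [MonoidHom.comp_apply, MonoidHom.comp_apply, MulEquiv.coe_toMonoidHom, MulEquiv.coe_toMonoidHom,
    zmodPowHom_apply, toAdd_ofAdd, MulAut.conj_apply]
  rcases (show g = 0 ∨ g = 1 by revert g; decide) with rfl | rfl
  · rw [phiII_zero, MulAut.one_apply, ZMod.val_zero, pow_zero, one_mul, inv_one, mul_one]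
  · rw [phiII_one, val_one_two, pow_one, NII_decomp x]
    simp only [map_mul, map_pow]
    rw [gv, gc, conj_pow, conj_pow, conj_mul]

/-- The model hom `H →* G`, `((n, e), g) ↦ vⁿ cᵉ uᵍ`. -/
def modelHomII (v c u : G) (hv : v ^ 6 = 1) (hc2 : c ^ 2 = 1) (hvc : v * c = c * v) (hu : u ^ 2 = 1)
    (huv : u * v * u⁻¹ = c * v⁻¹) (huc : u * c * u⁻¹ = c) : HII →* G :=
  SemidirectProduct.lift (nHom v c hv hc2 hvc) (zmodPowHom 2 u hu) (nHom_compat v c u hv hc2 hvc hu huv huc)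

/-- `modelHomII` on `⟨(n, e), g⟩`. -/
theorem modelHomII_mk (v c u : G) (hv : v ^ 6 = 1) (hc2 : c ^ 2 = 1) (hvc : v * c = c * v) (hu : u ^ 2 = 1)
    (huv : u * v * u⁻¹ = c * v⁻¹) (huc : u * c * u⁻¹ = c) (n : ZMod 6) (e : ZMod 2) (g : Multiplicative (ZMod 2)) :
    modelHomII v c u hv hc2 hvc hu huv huc ⟨(ofAdd n, ofAdd e), g⟩ = v ^ n.val * c ^ e.val * u ^ (toAdd g).val := by
  rw [SemidirectProduct.mk_eq_inl_mul_inr, map_mul, modelHomII, SemidirectProduct.lift_inl,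
    SemidirectProduct.lift_inr, nHom_apply, zmodPowHom_apply]

/-- The images of `v`, `c`, `u`. -/
theorem modelHomII_gen (v c u : G) (hv : v ^ 6 = 1) (hc2 : c ^ 2 = 1) (hvc : v * c = c * v) (hu : u ^ 2 = 1)
    (huv : u * v * u⁻¹ = c * v⁻¹) (huc : u * c * u⁻¹ = c) :
    modelHomII v c u hv hc2 hvc hu huv huc vII = v ∧ modelHomII v c u hv hc2 hvc hu huv huc cII = c ∧
    modelHomII v c u hv hc2 hvc hu huv huc uII = u := by
  have h1 : (1 : ZMod 6).val = 1 := by decide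
  refine ⟨?_, ?_, ?_⟩
  · rw [vII, show ((ofAdd 1, 1) : NII) = (ofAdd 1, ofAdd 0) from rfl, modelHomII, SemidirectProduct.lift_inl,
      nHom_apply, h1, ZMod.val_zero, pow_one, pow_zero, mul_one]
  · rw [cII, show ((1, ofAdd 1) : NII) = (ofAdd 0, ofAdd 1) from rfl, modelHomII, SemidirectProduct.lift_inl,
      nHom_apply, ZMod.val_zero, val_one_two, pow_zero, pow_one, one_mul]
  · rw [uII, modelHomII, SemidirectProduct.lift_inr, zmodPowHom_apply, toAdd_ofAdd, val_one_two, pow_one]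

/-- The twists `![1, u, v, v u]` are the images of `rectTII`. -/
theorem modelHomII_rectTII (v c u : G) (hv : v ^ 6 = 1) (hc2 : c ^ 2 = 1) (hvc : v * c = c * v) (hu : u ^ 2 = 1)
    (huv : u * v * u⁻¹ = c * v⁻¹) (huc : u * c * u⁻¹ = c) (i : Fin 4) :
    modelHomII v c u hv hc2 hvc hu huv huc (rectTII i) = ![1, u, v, v * u] i := by
  obtain ⟨gv, _, gu⟩ := modelHomII_gen v c u hv hc2 hvc hu huv huc
  fin_cases i
  · exact map_one _
  · exact gu
  · exact gv
  · show modelHomII v c u hv hc2 hvc hu huv huc (vII * uII) = v * u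
    rw [map_mul, gv, gu]

/-- `modelHomII` is injective for `v` of order 6, `c ∉ ⟨v⟩`, `u ∉ ⟨v, c⟩`. -/
theorem modelHomII_injective (v c u : G) (hv : v ^ 6 = 1) (hc2 : c ^ 2 = 1) (hvc : v * c = c * v)
    (hu : u ^ 2 = 1) (huv : u * v * u⁻¹ = c * v⁻¹) (huc : u * c * u⁻¹ = c) (hv6 : orderOf v = 6)
    (hcv : c ∉ Subgroup.zpowers v) (hunot : u ∉ Subgroup.closure ({v, c} : Set G)) :
    Function.Injective (modelHomII v c u hv hc2 hvc hu huv huc) := by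
  have hZ2 : ∀ y : ZMod 2, y = 0 ∨ y = 1 := by decide
  rw [injective_iff_map_eq_one]
  rintro ⟨⟨n, e⟩, g⟩ h
  obtain ⟨n, rfl⟩ := ofAdd.surjective n
  obtain ⟨e, rfl⟩ := ofAdd.surjective e
  obtain ⟨g, rfl⟩ := ofAdd.surjective g
  rw [modelHomII_mk, toAdd_ofAdd] at h
  have hvmem : v ∈ Subgroup.closure ({v, c} : Set G) := Subgroup.subset_closure (by simp)
  have hcmem : c ∈ Subgroup.closure ({v, c} : Set G) := Subgroup.subset_closure (by simp)
  rcases hZ2 g with rfl | rfl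
  · rw [ZMod.val_zero, pow_zero, mul_one] at h
    rcases hZ2 e with rfl | rfl
    · rw [ZMod.val_zero, pow_zero, mul_one] at h
      have h6 : 6 ∣ n.val := by
        have hd := orderOf_dvd_of_pow_eq_one h
        rwa [hv6] at hd
      have hn0 : n.val = 0 := Nat.eq_zero_of_dvd_of_lt h6 (ZMod.val_lt _)
      have hn : n = 0 := (ZMod.val_eq_zero _).mp hn0
      rw [hn]
      rfl
    · exfalso
      apply hcv
      rw [val_one_two, pow_one] at h
      rw [← inv_eq_of_mul_eq_one_right h]
      exact Subgroup.inv_mem _ (Subgroup.npow_mem_zpowers v _)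
  · exfalso
    apply hunot
    rw [val_one_two, pow_one] at h
    rw [← inv_eq_of_mul_eq_one_right h]
    exact Subgroup.inv_mem _ (Subgroup.mul_mem _ (Subgroup.pow_mem _ hvmem _) (Subgroup.pow_mem _ hcmem _))

/-! ### The theorem -/

/-- **Theorem T (ii) at `k = 3`, `ε = −` (route-2 §9.39 / §9.36(a), the `C₃ ⋊ D₄` row; kernel existence).**  For
every finite `(G, c)`, `v` of order `6` with `c ∉ ⟨v⟩` and an involution `u ∉ ⟨v, c⟩` with `u v u⁻¹ = c v⁻¹`: some CM
type has the twisted rectangle `Φ, Φu, Φv, Φ(vu)` `SumTwo` without a conjugate pair. -/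
theorem exists_twistedRectQuad_ii_k3 [Fintype G] [DecidableEq G] {c : G} (hc : IsComplexConj c) (v u : G)
    (hv6 : orderOf v = 6) (hu : u ^ 2 = 1) (huv : u * v * u⁻¹ = c * v⁻¹) (hcv : c ∉ Subgroup.zpowers v)
    (hunot : u ∉ Subgroup.closure ({v, c} : Set G)) :
    ∃ Φ : Finset G, IsCMType c Φ ∧ SumTwo (fun i => rmul Φ (![1, u, v, v * u] i)) ∧
      ∀ i j : Fin 4, rmul Φ (![1, u, v, v * u] j) ≠ c • rmul Φ (![1, u, v, v * u] i) := by
  have hv : v ^ 6 = 1 := by rw [← hv6]; exact pow_orderOf_eq_one v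
  have hc2 : c ^ 2 = 1 := conj_sq_eq_one hc
  have hvc : v * c = c * v := (hc.comm v).symm
  have huc : u * c * u⁻¹ = c := by rw [← hc.comm u, mul_assoc, mul_inv_cancel, mul_one]
  have hψ := modelHomII_injective v c u hv hc2 hvc hu huv huc hv6 hcv hunot
  have hcard : Fintype.card (Fin 1) * Fintype.card HII ≤ Fintype.card G := by
    rw [Fintype.card_fin, one_mul]
    exact Fintype.card_le_of_injective _ hψ
  have h1 : ∀ p : HII, decide (p * cII ∈ rectII) = !decide (p ∈ rectII) := by decide
  have h2 : ∀ p : HII, (univ.filter fun i : Fin 4 => decide (p * (rectTII i)⁻¹ ∈ rectII) = true).card = 2 := by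
    decide
  have h3 : ∀ i j : Fin 4, ¬ ∀ p : HII,
      (decide (p * (rectTII j)⁻¹ ∈ rectII) = true ↔ decide (p * (cII * (rectTII i)⁻¹) ∈ rectII) = true) := by
    decide
  obtain ⟨Φ, g1, g2, g3⟩ := exists_quad_of_pattern (modelHomII v c u hv hc2 hvc hu huv huc) hψ hc
    (modelHomII_gen v c u hv hc2 hvc hu huv huc).2.1 rectTII (fun (_ : Fin 1) p => decide (p ∈ rectII))
    (fun _ p => h1 p) (fun _ p => h2 p) (fun i j h => h3 i j (fun p => h 0 p)) hcard
  simp only [modelHomII_rectTII v c u hv hc2 hvc hu huv huc] at g2 g3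
  exact ⟨Φ, g1, g2, g3⟩

/-! ### The model itself -/

/-- `v` has order 6 in the model. -/
theorem orderOf_vII : orderOf vII = 6 := by
  rw [orderOf_eq_iff (by norm_num)]
  exact ⟨by decide, by decide⟩

/-- `c ∉ ⟨v⟩` in the model. -/
theorem cII_not_mem_zpowers : cII ∉ Subgroup.zpowers vII := by
  intro h
  obtain ⟨k, hk⟩ := Subgroup.mem_zpowers_iff.mp h
  have h' := congrArg
    (fun x : HII => (MonoidHom.snd (Multiplicative (ZMod 6)) (Multiplicative (ZMod 2))) x.left) hk
  rw [vII, cII, ← map_zpow, SemidirectProduct.left_inl, SemidirectProduct.left_inl, map_zpow] at h'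
  simp only [MonoidHom.coe_snd, one_zpow] at h'
  exact absurd h' (by decide)

/-- `u ∉ ⟨v, c⟩` in the model (the right projection separates them). -/
theorem uII_not_mem_closure : uII ∉ Subgroup.closure ({vII, cII} : Set HII) := by
  intro h
  have hle : Subgroup.closure ({vII, cII} : Set HII) ≤ (SemidirectProduct.rightHom).ker := by
    rw [Subgroup.closure_le]
    rintro x (rfl | rfl)
    · exact SemidirectProduct.rightHom_inl _
    · exact SemidirectProduct.rightHom_inl _
  have h' := hle h
  rw [MonoidHom.mem_ker, uII, SemidirectProduct.rightHom_inr] at h'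
  exact absurd h' (by decide)

/-- The twisted rectangle of sub-case (ii) on the model `C₃ ⋊ D₄` itself (degree 24). -/
theorem exists_twistedRectQuad_on_HII : ∃ Φ : Finset HII, IsCMType cII Φ ∧
    SumTwo (fun i => rmul Φ (![1, uII, vII, vII * uII] i)) ∧
    ∀ i j : Fin 4, rmul Φ (![1, uII, vII, vII * uII] j) ≠ cII • rmul Φ (![1, uII, vII, vII * uII] i) :=
  exists_twistedRectQuad_ii_k3 ⟨by decide, by decide, by decide⟩ _ _ orderOf_vII (by decide) (by decide)
    cII_not_mem_zpowers uII_not_mem_closure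

end HodgeRepro.TwistedQuadII
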